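import Summits.QuantumFields.BalabanUV.T4Continuum.Support.NE7CriticalTensionLetter
import HarnessLib

/-!
# NE7TensionGaugeLetter — THE TENSION LETTER IN ANY GAUGE AND IN FLAT FORM: the covariant log-chart tension of R2 is GAUGE COVARIANT
# (`T_{U^u}(x,ν) = Ad_{u(x)} T_U(x,ν)`, so R2's pointwise bound holds verbatim for `U^{u}`, every unitary site gauge `u`), and in a gauge whose links are
# within `r₀` of `1` it controls the FLAT lattice divergence of the flux form and of the plaquette DEVIATION form `U^u(∂p) − 1` up to `4d·r₀·a + 16d·a²`

Cell `pub-balaban`, rung (B)+1 sub-cell t4, lineage `b2b-balaban-t4-ne7-p1`, generation 72 (CRUX PROVER NE7 #1, OWNER row NE7).  File R3 of the REP♭ road, the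
docking piece between R2 `NE7CriticalTensionLetter.norm_tension_le_of_tanCritical` (p394435: `‖Σ_μ cDstar U μ (B·μν₀) x₀‖ ≤ card n·K` at every bond of the period
box, `K = c_R(Λ + (L∕L^d)^{k+1}) + 12·#Plane·a²`, for a tangent-critical admissible `U` with flat top average) and the co-owner's (156)–(158) gradient-currency chain
(t4-ne7-p2 g88: `a₁ ⇐ a₀ + j + ∇div A` for `U^{u₀} = e^{A}`, where `j` bounds the FLAT lattice divergence of the plaquette deviation field of `U^{u₀}`).
WHAT ([folklore]; 0 def, 0 sorry; every dimension `d`).  §1 COVARIANCE: `cDstar_gaugeAct_Ad` (`cDstar (U^u) μ (Ad_u g) x = Ad_{u(x)} (cDstar U μ g x)`),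
`fluxForm_gaugeAct` (the antisymmetrised flux form of `U^u` IS `Ad_u` of that of `U`, plaquette radius `a ≤ 1∕4`; the tree's `AveragingDeficitDerivWallProof.flux_gaugeAct`),
`tension_gaugeAct` (`T_{U^u} = Ad_u T_U`), `norm_tension_gaugeAct` (`‖T_{U^u}(x,ν)‖ = ‖T_U(x,ν)‖`); §2 **`norm_tension_gaugeAct_le_of_tanCritical`**: R2's bound for
`U^{u}`, every unitary `u` (periodic or not); §3 FLAT FORMS in a gauge `V` with `‖V(b) − 1‖ ≤ r₀` and plaquette radius `a ≤ 1∕4`: `norm_flatDiv_sub_tension_le`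
(`‖Σ_μ (B(x−e_μ)_{μν} − B(x)_{μν}) − T_ν(x)‖ ≤ 4d·r₀·a`: `‖Ad_{w}⁻¹X − X‖ ≤ 2‖w − 1‖‖X‖`, `‖B‖ ≤ 2a`), `norm_devForm_sub_fluxForm_le` (`‖D − B‖ ≤ 4a²` per plaquette
for the deviation form `D_{μν} = V(∂p) − 1`: `‖log W − (W − 1)‖ ≤ expRem(2‖W−1‖) ≤ 4‖W−1‖²`), **`norm_flatDiv_devForm_le`** (`‖Σ_μ (D(x−e_μ)_{μν} − D(x)_{μν})‖ ≤
‖T_ν(x)‖ + 4d·r₀·a + 8d·a²`).  So for `V = U^{u₀}` in [B8]'s gauge (`r₀ ≲ δ∕M`, `a = δ∕M²`): `j ≤ card n·K + 4dδ²M⁻³ + 8dδ²M⁻⁴` — B8's `α₀η³` currency, `α₀ ∝ δ`.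
HONEST FRAMING (page 1): kinematic letters about ONE configuration and R2 re-read in a gauge; the (1.9)-type INPUT of [B8] Theorem 2, NOT that theorem; REP♭ NOT
proved; (APE) NOT proved unconditionally; NOT ONE-STEP, NOT NE7; spine 0∕9; finite T⁴ rung (B)+1 — NOT infinite volume, NOT mass gap, NOT Clay.  Continuum YM on
T⁴ ⇐ BetaPertH ∧ nine spine estimates (0/9 proved); BetaPertH ⇐ (D1) ∧ (D4) ∧ CAP+tail; G-an2-4 gates asym, D1 and NE2/3/4.
-/

set_option autoImplicit false

open scoped BigOperators Matrix.Norms.L2Operator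
open NormedSpace Finset

namespace Summit.QuantumFields.BalabanUV.T4Continuum.NE7TensionGaugeLetter

open Literature.MathematicalPhysics.QuantumFieldTheory.Balaban1983to89
open B7Prop1Explicit B7Prop2Explicit MatrixLog UnitaryModel MatrixNorms
open T4AveragingDeficitWall (IsUnitaryCfg IsSkewDir SmallField dirL1 Ad flux fhol)
open T4AveragingDeficitWallBoundary (IsPeriodicCfg periodBox)
open T4AveragingDeficitNonAbelian (Ad_mul Ad_sub)
open AveragingDeficitTransport (norm_Ad_of_unitary val_inv_eq_star_of_unitary)
open AveragingDeficitNearIdentity (Ad_one Ad_neg Ad_sum norm_Ad_sub_le)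
open AveragingDeficitPeriodicCounting (IsPeriodicDir)
open AveragingDeficitMultiLevelPrep (cavgIter LevelSmall)
open AveragingDeficitDerivWallProof (flux_gaugeAct)
open ExpMeanLog (norm_star_sub_one)
open MinimalActionLevels (perWin)
open BlockAveragePushDirSplit (flat)
open NE3TangentCovariantTower (dirIter QbarIter)
open NE3HessForm (dAction)
open NE3CovariantCalculus (cDstar)
open NE3QbarIterCovLiftPrep (cruxC)
open NE3RightInverseSolveLetters (thetaLoc)
open NE3HatInvCurlLetters (curl1C)
open NE7FluxGradientFromTension (exists_fluxForm fluxForm_diag norm_fluxForm_le)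
open NE7CriticalTensionLetter (norm_tension_le_of_tanCritical)

noncomputable section

variable {d : ℕ} {n : Type*} [Fintype n] [DecidableEq n]

/-! ## §1 Gauge covariance of the flux form and of its tension -/

/-- **`cDstar` IS GAUGE COVARIANT ON `Ad`-TRANSPORTED FIELDS**: `cDstar (U^u) μ (y ↦ Ad_{u(y)} g(y)) x = Ad_{u(x)} (cDstar U μ g x)`. [folklore] -/
theorem cDstar_gaugeAct_Ad (u : Site d → (Matrix n n ℂ)ˣ) (U : Site d → Fin d → (Matrix n n ℂ)ˣ) (μ : Fin d) (g : Site d → Matrix n n ℂ) (x : Site d) :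
    cDstar (gaugeAct u U) μ (fun y => Ad (u y) (g y)) x = Ad (u x) (cDstar U μ g x) := by
  unfold cDstar
  rw [Ad_sub, ← Ad_mul, ← Ad_mul]
  congr 2
  simp only [gaugeAct, sub_add_cancel, mul_inv_rev, inv_inv, mul_assoc, inv_mul_cancel, mul_one]

section Forms

variable {U : Site d → Fin d → (Matrix n n ℂ)ˣ} {u : Site d → (Matrix n n ℂ)ˣ}
  {B B' : Site d → Fin d → Fin d → Matrix n n ℂ}

/-- **THE FLUX FORM OF `U^u` IS `Ad_u` OF THE FLUX FORM OF `U`** (plaquette radius `a ≤ 1∕4`, so the logarithm series converges and `log` commutes with unitary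
conjugation: the tree's `flux_gaugeAct`). [folklore] -/
theorem fluxForm_gaugeAct [Nonempty n] (hu : ∀ x, u x ∈ unitaryUnits (Matrix n n ℂ)) {a : ℝ} (ha4 : a ≤ 1 / 4) (hUa : SmallField U a)
    (hBF : ∀ (y : Site d) (μ ν : Fin d) (h : μ < ν), B y μ ν = flux U (y, ⟨(μ, ν), h⟩))
    (hanti : ∀ (y : Site d) (μ ν : Fin d), B y ν μ = -B y μ ν)
    (hBF' : ∀ (y : Site d) (μ ν : Fin d) (h : μ < ν), B' y μ ν = flux (gaugeAct u U) (y, ⟨(μ, ν), h⟩))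
    (hanti' : ∀ (y : Site d) (μ ν : Fin d), B' y ν μ = -B' y μ ν) (y : Site d) (μ ν : Fin d) :
    B' y μ ν = Ad (u y) (B y μ ν) := by
  have hball : ∀ (μ ν : Fin d) (h : μ < ν), ‖((fhol U (y, ⟨(μ, ν), h⟩) : (Matrix n n ℂ)ˣ) : Matrix n n ℂ) - 1‖ < 1 := fun μ ν h =>
    (hUa y μ ν (ne_of_lt h)).trans_lt (by linarith)
  have hAd0 : Ad (u y) (0 : Matrix n n ℂ) = 0 := by simp [Ad]
  rcases lt_trichotomy μ ν with h | h | h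
  · rw [hBF' y μ ν h, hBF y μ ν h]; exact flux_gaugeAct hu U _ (hball μ ν h)
  · subst h; rw [fluxForm_diag hanti', fluxForm_diag hanti, hAd0]
  · rw [hanti' y ν μ, hanti y ν μ, Ad_neg, hBF' y ν μ h, hBF y ν μ h, flux_gaugeAct hu U _ (hball ν μ h)]

/-- **THE TENSION IS GAUGE COVARIANT**: `T_{U^u}(x, ν) = Ad_{u(x)} T_U(x, ν)` for the flux forms `B` of `U` and `B'` of `U^u`. [folklore] -/
theorem tension_gaugeAct [Nonempty n] (hu : ∀ x, u x ∈ unitaryUnits (Matrix n n ℂ)) {a : ℝ} (ha4 : a ≤ 1 / 4) (hUa : SmallField U a)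
    (hBF : ∀ (y : Site d) (μ ν : Fin d) (h : μ < ν), B y μ ν = flux U (y, ⟨(μ, ν), h⟩))
    (hanti : ∀ (y : Site d) (μ ν : Fin d), B y ν μ = -B y μ ν)
    (hBF' : ∀ (y : Site d) (μ ν : Fin d) (h : μ < ν), B' y μ ν = flux (gaugeAct u U) (y, ⟨(μ, ν), h⟩))
    (hanti' : ∀ (y : Site d) (μ ν : Fin d), B' y ν μ = -B' y μ ν) (x : Site d) (ν : Fin d) :
    ∑ μ : Fin d, cDstar (gaugeAct u U) μ (fun w => B' w μ ν) x = Ad (u x) (∑ μ : Fin d, cDstar U μ (fun w => B w μ ν) x) := by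
  rw [Ad_sum]
  refine Finset.sum_congr rfl fun μ _ => ?_
  rw [show (fun w => B' w μ ν) = fun w => Ad (u w) (B w μ ν) from funext fun w => fluxForm_gaugeAct hu ha4 hUa hBF hanti hBF' hanti' w μ ν]
  exact cDstar_gaugeAct_Ad u U μ _ x

/-- **`‖T_{U^u}(x, ν)‖ = ‖T_U(x, ν)‖`** (unitary conjugation is isometric). [folklore] -/
theorem norm_tension_gaugeAct [Nonempty n] (hu : ∀ x, u x ∈ unitaryUnits (Matrix n n ℂ)) {a : ℝ} (ha4 : a ≤ 1 / 4) (hUa : SmallField U a)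
    (hBF : ∀ (y : Site d) (μ ν : Fin d) (h : μ < ν), B y μ ν = flux U (y, ⟨(μ, ν), h⟩))
    (hanti : ∀ (y : Site d) (μ ν : Fin d), B y ν μ = -B y μ ν)
    (hBF' : ∀ (y : Site d) (μ ν : Fin d) (h : μ < ν), B' y μ ν = flux (gaugeAct u U) (y, ⟨(μ, ν), h⟩))
    (hanti' : ∀ (y : Site d) (μ ν : Fin d), B' y ν μ = -B' y μ ν) (x : Site d) (ν : Fin d) :
    ‖∑ μ : Fin d, cDstar (gaugeAct u U) μ (fun w => B' w μ ν) x‖ = ‖∑ μ : Fin d, cDstar U μ (fun w => B w μ ν) x‖ := by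
  rw [tension_gaugeAct hu ha4 hUa hBF hanti hBF' hanti', norm_Ad_of_unitary (hu x)]

end Forms

/-! ## §2 R2's pointwise bound in any gauge -/

/-- **THE POINTWISE TENSION LETTER IN ANY GAUGE**: under R2's hypotheses on `U` (`NE7CriticalTensionLetter.norm_tension_le_of_tanCritical`) and for every
unitary site gauge `u` (no periodicity needed) and the flux form `B'` of `U^u`: `‖Σ_μ cDstar (U^u) μ (B'·μν₀) x₀‖ ≤ card n·(c_R(Λ + (L∕L^d)^{k+1}) + 12·#Plane·a²)` at
every bond of the period box. [folklore] -/
theorem norm_tension_gaugeAct_le_of_tanCritical [Nonempty n] {L : ℕ} (hL : 2 ≤ L) (k : ℕ) {N : ℕ} [NeZero N]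
    {U : Site d → Fin d → (Matrix n n ℂ)ˣ} {x a Λ : ℝ}
    (hUu : IsUnitaryCfg U) (hUP : IsPeriodicCfg U ((N * L ^ (k + 1) : ℕ) : ℤ)) (hx : 0 ≤ x) (hs : LevelSmall d L k x) (hUx : SmallField U x)
    (hθ : cruxC d L * (((L : ℝ) ^ (k + 1)) ^ 2 * x) < 1) (hθl : thetaLoc d L * (((L : ℝ) ^ (k + 1)) ^ 2 * x) < 1)
    (hε : ((L : ℝ) ^ (k + 1)) ^ 2 * x ≤ 1) (ha : 0 ≤ a) (ha4 : a ≤ 1 / 4) (hUa : SmallField U a)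
    (hflatTop : cavgIter L (k + 1) U = flat) (hΛ0 : 0 ≤ Λ)
    (hΛ : ∀ Y : Site d → Fin d → Matrix n n ℂ, IsSkewDir Y → IsPeriodicDir Y ((N * L ^ (k + 1) : ℕ) : ℤ) →
      ∑ z ∈ periodBox N, ∑ κ : Fin d, ‖QbarIter L (k + 1) U Y z κ - QbarIter L (k + 1) (flat (d := d) (n := n)) Y z κ‖
        ≤ Λ * dirL1 Y (periodBox (d := d) (N * L ^ (k + 1))))
    (hcrit : ∀ Y' : Site d → Fin d → Matrix n n ℂ, IsSkewDir Y' → IsPeriodicDir Y' ((N * L ^ (k + 1) : ℕ) : ℤ) →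
      dirIter L (k + 1) U Y' = 0 → dAction U Y' (perWin d (N * L ^ (k + 1))) = 0)
    {u : Site d → (Matrix n n ℂ)ˣ} (hu : ∀ x, u x ∈ unitaryUnits (Matrix n n ℂ))
    {B' : Site d → Fin d → Fin d → Matrix n n ℂ}
    (hBF' : ∀ (y : Site d) (μ ν : Fin d) (h : μ < ν), B' y μ ν = flux (gaugeAct u U) (y, ⟨(μ, ν), h⟩))
    (hanti' : ∀ (y : Site d) (μ ν : Fin d), B' y ν μ = -B' y μ ν)
    {x₀ : Site d} (hx₀ : x₀ ∈ periodBox (d := d) (N * L ^ (k + 1))) (ν₀ : Fin d) :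
    ‖∑ μ : Fin d, cDstar (gaugeAct u U) μ (fun w => B' w μ ν₀) x₀‖
      ≤ Fintype.card n *
          ((a * ((curl1C d L / (1 - thetaLoc d L * (((L : ℝ) ^ (k + 1)) ^ 2 * x))) * (((L : ℝ) ^ (k + 1)) ^ d / ((L : ℝ) ^ (k + 1)) ^ 2)))
              * (Λ + ((L : ℝ) / (L : ℝ) ^ d) ^ (k + 1))
            + 12 * (Fintype.card (T4AveragingDeficitWall.Plane d) : ℝ) * a ^ 2) := by
  obtain ⟨B, hBF, hanti⟩ := exists_fluxForm U
  rw [norm_tension_gaugeAct hu ha4 hUa hBF hanti hBF' hanti']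
  exact norm_tension_le_of_tanCritical hL k hUu hUP hx hs hUx hθ hθl hε ha ha4 hUa hflatTop hΛ0 hΛ hcrit hBF hanti hx₀ ν₀

/-! ## §3 Flat forms in a gauge whose links are near `1` -/

section Flat

variable {V : Site d → Fin d → (Matrix n n ℂ)ˣ} {B D : Site d → Fin d → Fin d → Matrix n n ℂ}

/-- **FLAT VERSUS COVARIANT DIVERGENCE OF THE FLUX FORM**: if every link of the unitary `V` is within `r₀` of `1` and the plaquette radius is `a ≤ 1∕4`, then
`‖Σ_μ (B(x−e_μ)_{μν} − B(x)_{μν}) − T_ν(x)‖ ≤ 4d·r₀·a` (`‖X − Ad_{w}⁻¹X‖ ≤ 2‖w − 1‖‖X‖`, `‖B‖ ≤ 2a`). [folklore] -/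
theorem norm_flatDiv_sub_tension_le [Nonempty n] (hVu : IsUnitaryCfg V) {r₀ : ℝ}
    (hr₀ : ∀ (y : Site d) (κ : Fin d), ‖((V y κ : (Matrix n n ℂ)ˣ) : Matrix n n ℂ) - 1‖ ≤ r₀)
    {a : ℝ} (ha : 0 ≤ a) (ha4 : a ≤ 1 / 4) (hVa : SmallField V a)
    (hBF : ∀ (y : Site d) (μ ν : Fin d) (h : μ < ν), B y μ ν = flux V (y, ⟨(μ, ν), h⟩))
    (hanti : ∀ (y : Site d) (μ ν : Fin d), B y ν μ = -B y μ ν) (x : Site d) (ν : Fin d) :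
    ‖(∑ μ : Fin d, (B (x - e μ) μ ν - B x μ ν)) - ∑ μ : Fin d, cDstar V μ (fun w => B w μ ν) x‖ ≤ 4 * (d : ℝ) * r₀ * a := by
  rw [← Finset.sum_sub_distrib]
  have hterm : ∀ μ : Fin d, ‖(B (x - e μ) μ ν - B x μ ν) - cDstar V μ (fun w => B w μ ν) x‖ ≤ 4 * r₀ * a := by
    intro μ
    have hw : (V (x - e μ) μ)⁻¹ ∈ unitaryUnits (Matrix n n ℂ) := (unitaryUnits _).inv_mem (hVu _ _)
    have hw1 : ‖(((V (x - e μ) μ)⁻¹ : (Matrix n n ℂ)ˣ) : Matrix n n ℂ) - 1‖ ≤ r₀ := by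
      rw [val_inv_eq_star_of_unitary (hVu _ _), norm_star_sub_one]; exact hr₀ _ _
    have hB2 : ‖B (x - e μ) μ ν‖ ≤ 2 * a := norm_fluxForm_le ha (by linarith) hVa hBF hanti _ _ _
    have h1 := norm_Ad_sub_le hw (B (x - e μ) μ ν)
    have hr₀0 : 0 ≤ r₀ := (norm_nonneg _).trans (hr₀ x ν)
    calc ‖(B (x - e μ) μ ν - B x μ ν) - cDstar V μ (fun w => B w μ ν) x‖
        = ‖Ad (V (x - e μ) μ)⁻¹ (B (x - e μ) μ ν) - B (x - e μ) μ ν‖ := by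
          unfold cDstar; rw [← norm_neg]; congr 1; abel
      _ ≤ 2 * ‖(((V (x - e μ) μ)⁻¹ : (Matrix n n ℂ)ˣ) : Matrix n n ℂ) - 1‖ * ‖B (x - e μ) μ ν‖ := h1
      _ ≤ 2 * r₀ * (2 * a) := by gcongr
      _ = 4 * r₀ * a := by ring
  calc ‖∑ μ : Fin d, ((B (x - e μ) μ ν - B x μ ν) - cDstar V μ (fun w => B w μ ν) x)‖
      ≤ ∑ μ : Fin d, ‖(B (x - e μ) μ ν - B x μ ν) - cDstar V μ (fun w => B w μ ν) x‖ := norm_sum_le _ _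
    _ ≤ ∑ _μ : Fin d, 4 * r₀ * a := Finset.sum_le_sum fun μ _ => hterm μ
    _ = 4 * (d : ℝ) * r₀ * a := by rw [Finset.sum_const, Finset.card_univ, Fintype.card_fin, nsmul_eq_mul]; ring

/-- **THE DEVIATION FORM IS `4a²`-CLOSE TO THE FLUX FORM**: for the antisymmetrised deviation form `D_{μν}(y) = V(∂p) − 1` and flux form `B_{μν}(y) = log V(∂p)`
of a configuration of plaquette radius `a ≤ 1∕4`: `‖D(y)_{μν} − B(y)_{μν}‖ ≤ 4a²` (`‖log W − (W−1)‖ ≤ expRem(2‖W−1‖) ≤ 4‖W−1‖²`). [folklore] -/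
theorem norm_devForm_sub_fluxForm_le {a : ℝ} (ha4 : a ≤ 1 / 4) (hVa : SmallField V a)
    (hBF : ∀ (y : Site d) (μ ν : Fin d) (h : μ < ν), B y μ ν = flux V (y, ⟨(μ, ν), h⟩))
    (hanti : ∀ (y : Site d) (μ ν : Fin d), B y ν μ = -B y μ ν)
    (hDF : ∀ (y : Site d) (μ ν : Fin d) (h : μ < ν), D y μ ν = ((fhol V (y, ⟨(μ, ν), h⟩) : (Matrix n n ℂ)ˣ) : Matrix n n ℂ) - 1)
    (hDanti : ∀ (y : Site d) (μ ν : Fin d), D y ν μ = -D y μ ν) (y : Site d) (μ ν : Fin d) :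
    ‖D y μ ν - B y μ ν‖ ≤ 4 * a ^ 2 := by
  have hlt : ∀ (μ ν : Fin d) (h : μ < ν), ‖D y μ ν - B y μ ν‖ ≤ 4 * a ^ 2 := by
    intro μ ν h
    have hW : ‖((fhol V (y, ⟨(μ, ν), h⟩) : (Matrix n n ℂ)ˣ) : Matrix n n ℂ) - 1‖ ≤ a := hVa y μ ν (ne_of_lt h)
    have h1 := norm_mlog_sub_le (hW.trans (by linarith))
    have h2 : expRem (2 * ‖((fhol V (y, ⟨(μ, ν), h⟩) : (Matrix n n ℂ)ˣ) : Matrix n n ℂ) - 1‖) ≤ (2 * a) ^ 2 :=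
      (expRem_le_sq (by positivity) (by linarith)).trans (by gcongr)
    rw [hDF y μ ν h, hBF y μ ν h, ← norm_neg, neg_sub]
    unfold flux
    linarith
  rcases lt_trichotomy μ ν with h | h | h
  · exact hlt μ ν h
  · subst h
    rw [fluxForm_diag hDanti, fluxForm_diag hanti, sub_zero, norm_zero]; positivity
  · rw [hDanti y ν μ, hanti y ν μ, ← neg_sub', norm_neg]  -- `-D - (-B) = -(D - B)`
    exact hlt ν μ h

/-- **THE FLAT DIVERGENCE OF THE DEVIATION FORM FROM THE TENSION**: links within `r₀` of `1`, plaquette radius `a ≤ 1∕4`: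
`‖Σ_μ (D(x−e_μ)_{μν} − D(x)_{μν})‖ ≤ ‖T_ν(x)‖ + 4d·r₀·a + 8d·a²` — the co-owner's `j` from R2's pointwise tension bound, inside B8's `α₀η³` currency
(`r₀ ≲ δ∕M`, `a = δ∕M²`). [folklore] -/
theorem norm_flatDiv_devForm_le [Nonempty n] (hVu : IsUnitaryCfg V) {r₀ : ℝ}
    (hr₀ : ∀ (y : Site d) (κ : Fin d), ‖((V y κ : (Matrix n n ℂ)ˣ) : Matrix n n ℂ) - 1‖ ≤ r₀)
    {a : ℝ} (ha : 0 ≤ a) (ha4 : a ≤ 1 / 4) (hVa : SmallField V a)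
    (hBF : ∀ (y : Site d) (μ ν : Fin d) (h : μ < ν), B y μ ν = flux V (y, ⟨(μ, ν), h⟩))
    (hanti : ∀ (y : Site d) (μ ν : Fin d), B y ν μ = -B y μ ν)
    (hDF : ∀ (y : Site d) (μ ν : Fin d) (h : μ < ν), D y μ ν = ((fhol V (y, ⟨(μ, ν), h⟩) : (Matrix n n ℂ)ˣ) : Matrix n n ℂ) - 1)
    (hDanti : ∀ (y : Site d) (μ ν : Fin d), D y ν μ = -D y μ ν) (x : Site d) (ν : Fin d) :
    ‖∑ μ : Fin d, (D (x - e μ) μ ν - D x μ ν)‖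
      ≤ ‖∑ μ : Fin d, cDstar V μ (fun w => B w μ ν) x‖ + 4 * (d : ℝ) * r₀ * a + 8 * (d : ℝ) * a ^ 2 := by
  have hDB : ‖∑ μ : Fin d, (D (x - e μ) μ ν - D x μ ν) - ∑ μ : Fin d, (B (x - e μ) μ ν - B x μ ν)‖ ≤ 8 * (d : ℝ) * a ^ 2 := by
    rw [← Finset.sum_sub_distrib]
    calc ‖∑ μ : Fin d, ((D (x - e μ) μ ν - D x μ ν) - (B (x - e μ) μ ν - B x μ ν))‖
        ≤ ∑ μ : Fin d, ‖(D (x - e μ) μ ν - D x μ ν) - (B (x - e μ) μ ν - B x μ ν)‖ := norm_sum_le _ _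
      _ ≤ ∑ _μ : Fin d, (4 * a ^ 2 + 4 * a ^ 2) := Finset.sum_le_sum fun μ _ => by
          rw [show (D (x - e μ) μ ν - D x μ ν) - (B (x - e μ) μ ν - B x μ ν)
              = (D (x - e μ) μ ν - B (x - e μ) μ ν) - (D x μ ν - B x μ ν) by abel]
          exact (norm_sub_le _ _).trans (add_le_add (norm_devForm_sub_fluxForm_le ha4 hVa hBF hanti hDF hDanti _ _ _)
            (norm_devForm_sub_fluxForm_le ha4 hVa hBF hanti hDF hDanti _ _ _))
      _ = 8 * (d : ℝ) * a ^ 2 := by rw [Finset.sum_const, Finset.card_univ, Fintype.card_fin, nsmul_eq_mul]; ring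
  have hBT := norm_flatDiv_sub_tension_le hVu hr₀ ha ha4 hVa hBF hanti x ν
  have h3 := norm_sub_le_norm_sub_add_norm_sub (∑ μ : Fin d, (D (x - e μ) μ ν - D x μ ν)) (∑ μ : Fin d, (B (x - e μ) μ ν - B x μ ν))
    (∑ μ : Fin d, cDstar V μ (fun w => B w μ ν) x)
  have h4 := norm_sub_norm_le (∑ μ : Fin d, (D (x - e μ) μ ν - D x μ ν)) (∑ μ : Fin d, cDstar V μ (fun w => B w μ ν) x)
  linarith

end Flat

end

end Summit.QuantumFields.BalabanUV.T4Continuum.NE7TensionGaugeLetter
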